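import Literature.Analysis.FunctionSpaces.TorusTrilinearH1
import HarnessLib

/-!
# Functional mining: codomain-generic Poincaré–Wirtinger and mean-zero Sobolev on `T³`

Search for candidate a priori estimates; no regularity claim.

The tree's Bochner-form Poincaré–Wirtinger inequality
`Torus.integral_norm_sq_le_card_pow_mul_gradNormSq` and mean-zero Sobolev embedding
`Torus.exists_integral_norm_pow_six_le_gradNormSq_cube` are stated for velocity fields
`UnitAddTorus d → EuclideanSpace ℝ d` through the squared gradient norm `Torus.gradNormSq`.
The underlying spectral / Gagliardo–Nirenberg lemmas
(`Torus.integral_norm_sq_le_of_hasZeroMean`, `Torus.lintegral_enorm_pow_six_le_cube_of_isSmooth`,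
`Torus.norm_fderiv_sq_le_card_mul_sum`) are codomain-generic, and this file records the two
inequalities for smooth zero-mean maps into an arbitrary finite-dimensional real normed space `F`,
with the coordinate form `∫ ∑ₖ ‖∂ₖ v‖²` of the Dirichlet integral:

* `integral_norm_sq_le_card_cube_mul` : `∫ ‖v‖² ≤ d³ ∫ ∑ₖ ‖∂ₖ v‖²`;
* `exists_integral_norm_pow_six_le_cube` (`#d = 3`) : `∫ ‖v‖⁶ ≤ C (∫ ∑ₖ ‖∂ₖ v‖²)³`.

These are the static bricks needed to run the nonlinear Poincaré / Sobolev top node of the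
vorticity-moment ladder for tensor-valued test maps (strain moments `∫ |S|^q`, rows `ES.absS.q`
of the 𝒦₀ matrix), where the test map `|S|^{a} S` takes values in `d × d` matrices.
-/

noncomputable section

open MeasureTheory
open Literature.Analysis.FunctionSpaces Literature.Analysis.FunctionSpaces.Torus

namespace Summit.NavierStokesRegularity.FunctionalMining.CodomainSobolev

variable {d : Type*} [Fintype d] [DecidableEq d]
variable {F : Type*} [NormedAddCommGroup F] [NormedSpace ℝ F] [FiniteDimensional ℝ F]

omit [FiniteDimensional ℝ F] in
/-- `∫ ‖Dv‖² ≤ d ∫ ∑ₖ ‖∂ₖ v‖² for smooth maps `v : T^d → F` (Cauchy–Schwarz on the operator norm,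
integrated). -/
theorem integral_norm_fderiv_sq_le_card_mul {v : UnitAddTorus d → F} (hv : IsSmooth v) :
    ∫ x, ‖Torus.fderiv v x‖ ^ 2 ≤
      (Fintype.card d : ℝ) * ∫ x, ∑ k, ‖Torus.partialDeriv k v x‖ ^ 2 := by
  have hc2 : Continuous fun x => ∑ k, ‖Torus.partialDeriv k v x‖ ^ 2 :=
    continuous_finsetSum _ fun k _ => ((hv.partialDeriv k).continuous.norm.pow 2)
  calc ∫ x, ‖Torus.fderiv v x‖ ^ 2
      ≤ ∫ x, (Fintype.card d : ℝ) * ∑ k, ‖Torus.partialDeriv k v x‖ ^ 2 :=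
        integral_mono ((continuous_fderiv_of_isSmooth hv).norm.pow 2).integrable_unitAddTorus
          (hc2.integrable_unitAddTorus.const_mul _)
          fun x => norm_fderiv_sq_le_card_mul_sum (hv.isContDiff (by simp)) x
    _ = (Fintype.card d : ℝ) * ∫ x, ∑ k, ‖Torus.partialDeriv k v x‖ ^ 2 := integral_const_mul _ _

/-- **Codomain-generic Poincaré–Wirtinger, coordinate form**: for a smooth zero-mean map
`v : T^d → F`, `∫ ‖v‖² ≤ d³ ∫ ∑ₖ ‖∂ₖ v‖²`. [folklore] -/
theorem integral_norm_sq_le_card_cube_mul {v : UnitAddTorus d → F} (hv : IsSmooth v)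
    (h0 : HasZeroMean v) :
    ∫ x, ‖v x‖ ^ 2 ≤ (Fintype.card d : ℝ) ^ 3 * ∫ x, ∑ k, ‖Torus.partialDeriv k v x‖ ^ 2 := by
  haveI : CompleteSpace F := FiniteDimensional.complete ℝ F
  have h1 := integral_norm_sq_le_of_hasZeroMean hv h0
  have h2 := integral_norm_fderiv_sq_le_card_mul hv
  have hd0 : (0 : ℝ) ≤ (Fintype.card d : ℝ) ^ 2 := by positivity
  calc ∫ x, ‖v x‖ ^ 2 ≤ (Fintype.card d : ℝ) ^ 2 * ∫ x, ‖Torus.fderiv v x‖ ^ 2 := h1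
    _ ≤ (Fintype.card d : ℝ) ^ 2 *
          ((Fintype.card d : ℝ) * ∫ x, ∑ k, ‖Torus.partialDeriv k v x‖ ^ 2) :=
        mul_le_mul_of_nonneg_left h2 hd0
    _ = (Fintype.card d : ℝ) ^ 3 * ∫ x, ∑ k, ‖Torus.partialDeriv k v x‖ ^ 2 := by ring

/-- **Codomain-generic mean-zero Sobolev embedding on `T³`, Bochner form**: there is `C ≥ 0`
with `∫ ‖v‖⁶ ≤ C (∫ ∑ₖ ‖∂ₖ v‖²)³` for every smooth zero-mean `v : T³ → F`.  This is
`Torus.lintegral_enorm_pow_six_le_cube_of_isSmooth` combined with the Poincaré–Wirtinger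
inequality above. [folklore] -/
theorem exists_integral_norm_pow_six_le_cube (hd : Fintype.card d = 3) :
    ∃ C : ℝ, 0 ≤ C ∧ ∀ v : UnitAddTorus d → F, IsSmooth v → HasZeroMean v →
      ∫ x, ‖v x‖ ^ 6 ≤ C * (∫ x, ∑ k, ‖Torus.partialDeriv k v x‖ ^ 2) ^ 3 := by
  haveI : CompleteSpace F := FiniteDimensional.complete ℝ F
  obtain ⟨K, hK⟩ := Torus.lintegral_enorm_pow_six_le_cube_of_isSmooth (F' := F) hd
  have hK0 : (0 : ℝ) ≤ K := NNReal.coe_nonneg K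
  refine ⟨(K : ℝ) * (((Fintype.card d : ℝ) ^ 2 + 1) * Fintype.card d) ^ 3, by positivity,
    fun w hws hw0 => ?_⟩
  have hwc : Continuous w := hws.continuous
  have hDc : Continuous (Torus.fderiv w) := Torus.continuous_fderiv_of_isSmooth hws
  set G : ℝ := ∫ x, ∑ k, ‖Torus.partialDeriv k w x‖ ^ 2 with hG
  have hG0 : 0 ≤ G :=
    integral_nonneg fun x => Finset.sum_nonneg fun k _ => sq_nonneg _
  have h6 := hK w hws
  have conv : ∀ {g : UnitAddTorus d → ℝ} (_ : Continuous g) (_ : ∀ x, 0 ≤ g x) (k : ℕ),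
      ∫⁻ x, (ENNReal.ofReal (g x)) ^ k = ENNReal.ofReal (∫ x, g x ^ k) := by
    intro g hg hg0 k
    have hi : Integrable (fun x => g x ^ k) volume := (hg.pow k).integrable_unitAddTorus
    rw [ofReal_integral_eq_lintegral_ofReal hi (ae_of_all _ fun x => pow_nonneg (hg0 x) k)]
    exact lintegral_congr fun x => (ENNReal.ofReal_pow (hg0 x) k).symm
  have e6 : ∫⁻ x, ‖w x‖ₑ ^ 6 = ENNReal.ofReal (∫ x, ‖w x‖ ^ 6) := by
    rw [← conv hwc.norm (fun x => norm_nonneg _) 6]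
    exact lintegral_congr fun x => by rw [ofReal_norm]
  have e2 : ∫⁻ x, ‖w x‖ₑ ^ 2 = ENNReal.ofReal (∫ x, ‖w x‖ ^ 2) := by
    rw [← conv hwc.norm (fun x => norm_nonneg _) 2]
    exact lintegral_congr fun x => by rw [ofReal_norm]
  have eD : ∫⁻ x, ‖Torus.fderiv w x‖ₑ ^ 2 = ENNReal.ofReal (∫ x, ‖Torus.fderiv w x‖ ^ 2) := by
    rw [← conv hDc.norm (fun x => norm_nonneg _) 2]
    exact lintegral_congr fun x => by rw [ofReal_norm]
  have hA0 : 0 ≤ ∫ x, ‖w x‖ ^ 2 := integral_nonneg fun x => sq_nonneg _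
  have hB0 : 0 ≤ ∫ x, ‖Torus.fderiv w x‖ ^ 2 := integral_nonneg fun x => sq_nonneg _
  rw [e6, e2, eD, ← ENNReal.ofReal_add hA0 hB0, ← ENNReal.ofReal_pow (by positivity),
    ← ENNReal.ofReal_coe_nnreal, ← ENNReal.ofReal_mul hK0] at h6
  have h6' : ∫ x, ‖w x‖ ^ 6 ≤ K * ((∫ x, ‖w x‖ ^ 2) + ∫ x, ‖Torus.fderiv w x‖ ^ 2) ^ 3 :=
    (ENNReal.ofReal_le_ofReal_iff (by positivity)).1 h6
  have hPoinc : ∫ x, ‖w x‖ ^ 2 ≤ (Fintype.card d : ℝ) ^ 2 * ∫ x, ‖Torus.fderiv w x‖ ^ 2 :=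
    Torus.integral_norm_sq_le_of_hasZeroMean hws hw0
  have hDw : ∫ x, ‖Torus.fderiv w x‖ ^ 2 ≤ Fintype.card d * G :=
    integral_norm_fderiv_sq_le_card_mul hws
  have hsum2 : (∫ x, ‖w x‖ ^ 2) + ∫ x, ‖Torus.fderiv w x‖ ^ 2 ≤
      ((Fintype.card d : ℝ) ^ 2 + 1) * Fintype.card d * G := by
    have hd1 : (0 : ℝ) ≤ (Fintype.card d : ℝ) ^ 2 + 1 := by positivity
    calc (∫ x, ‖w x‖ ^ 2) + ∫ x, ‖Torus.fderiv w x‖ ^ 2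
        ≤ (Fintype.card d : ℝ) ^ 2 * (∫ x, ‖Torus.fderiv w x‖ ^ 2) +
            ∫ x, ‖Torus.fderiv w x‖ ^ 2 := by linarith [hPoinc]
      _ = ((Fintype.card d : ℝ) ^ 2 + 1) * ∫ x, ‖Torus.fderiv w x‖ ^ 2 := by ring
      _ ≤ ((Fintype.card d : ℝ) ^ 2 + 1) * (Fintype.card d * G) :=
          mul_le_mul_of_nonneg_left hDw hd1
      _ = ((Fintype.card d : ℝ) ^ 2 + 1) * Fintype.card d * G := by ring
  have hS0 : 0 ≤ (∫ x, ‖w x‖ ^ 2) + ∫ x, ‖Torus.fderiv w x‖ ^ 2 := add_nonneg hA0 hB0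
  calc ∫ x, ‖w x‖ ^ 6 ≤ K * ((∫ x, ‖w x‖ ^ 2) + ∫ x, ‖Torus.fderiv w x‖ ^ 2) ^ 3 := h6'
    _ ≤ K * (((Fintype.card d : ℝ) ^ 2 + 1) * Fintype.card d * G) ^ 3 := by
        gcongr
    _ = K * (((Fintype.card d : ℝ) ^ 2 + 1) * Fintype.card d) ^ 3 * G ^ 3 := by ring

end Summit.NavierStokesRegularity.FunctionalMining.CodomainSobolev

end
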